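import Literature.AlgebraicGeometry.Resolution.RsopMonomialIdeals
import Literature.AlgebraicGeometry.Resolution.ArithmeticalThreefoldsAlgebraization
import Mathlib.LinearAlgebra.Matrix.ToLinearEquiv
import Mathlib.LinearAlgebra.Matrix.Adjugate
import Mathlib.RingTheory.Valuation.Integers
import Mathlib.RingTheory.Prime
import Mathlib.Data.Fintype.Sigma
import HarnessLib

/-!
# Cossart–Piltant 2019, proof of Prop. 4.8: the monomial linear algebra (511)

Topic: `Literature/AlgebraicGeometry/Resolution` (proofs only; no new notions, no new named
facts). The named fact `CossartPiltant2019LU3OfComplete` (`ArithmeticalThreefolds.lean`) is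
journal Prop. 4.8 = arXiv v1 Prop. 4.6 of

* V. Cossart, O. Piltant, *Resolution of singularities of arithmetical threefolds*, J. Algebra
  529 (2019) 268–535 = arXiv:1412.0868 (v1, pp. 52–53),

the descent of (LU) from the formal completion `Â` of a quasi-excellent local domain `A` of
dimension three to `A`. With `𝒪_{Ŷ,ŷ}` the (regular) local ring of a resolution `Ŷ → Spec Â` at
the centre `ŷ` of an extension `v̂` of the valuation `v`, `h = g f₁ ⋯ f_r ∈ A` with
`v(f₁), …, v(f_r)` `ℚ`-linearly independent in `Γ_v`, and (Lemma 4.7 = [CoP1] Prop. 6.2)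
`√(h𝒪_{Ŷ,ŷ}) = (û₁ ⋯ û_r)` for a regular system of parameters `(û₁, …, û_d)` of `𝒪_{Ŷ,ŷ}`, the
printed proof continues (p. 53):

> "In particular `v̂(û₁), …, v̂(û_r) ∈ Γ_v ⊗_ℤ ℚ` and these values are `ℚ`-linearly independent.
> […] By elementary linear algebra, there exists an `r × r` matrix `M ∈ ℳ(r, ℤ)`,
> `a = det M > 0` such that `g_j := ∏_{i=1}^r f_i^{m_{ij}} = δ̂_j û_j^a ∈ 𝒪_{Ŷ,ŷ} ∩ K` (511),
> where `δ̂_j ∈ 𝒪_{Ŷ,ŷ}` is a unit, `1 ≤ j ≤ r`."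

This file PROVES these two sentences as abstract algebra, and packages them for the
algebraization interface `exists_adjoin_isRegularLocalRing_of_generators`
(`ArithmeticalThreefoldsAlgebraization.lean`), whose input is a finite family of elements of
`𝔪_S` (`S = 𝒪_{Ŷ,ŷ}`) coming from `K` and generating an `𝔪_S`-primary ideal:

* `CossartPiltantMonomial.exists_eq_units_mul_prod_pow_of_dvd` — in a cancellative monoid, a
  divisor of `∏ pᵢ^{Nᵢ}` (`pᵢ` prime) is a unit times `∏ pᵢ^{eᵢ}`; hence each `f_i`, dividing
  `h ∣ (û₁ ⋯ û_r)^N`, is `δ_i ∏ û_k^{e_{ik}}` with `δ_i` a unit (the `û_k` are prime,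
  `IsRsopPart.prime`);
* `CossartPiltantMonomial.exists_matrix_of_independent` — the "elementary linear algebra" in a
  commutative group: the exponent matrix `E = (e_{ik})` is nonsingular because the values
  `v(f_i) = ∑_k e_{ik} v̂(û_k)` are independent (`Matrix.exists_vecMul_eq_zero_iff` over `ℤ`),
  `M := sign(det E) · adj E` satisfies `M E = a · 1` with `a = |det E| > 0`
  (`Matrix.adjugate_mul`), so `∏ᵢ f_i^{m_{ji}} = (∏ᵢ δ_i^{m_{ji}}) û_j^a`, and the `v̂(û_k)` are
  independent as well;
* `CossartPiltantMonomial.exists_prod_zpow_eq_units_mul_pow` — the same inside a field `L ⊇ S`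
  with a valuation `v` of `L` that is `≤ 1` on `S` (units of `S` have value `1`,
  `Valuation.Integers.one_of_isUnit'`);
* `IsRsopPart.exists_prod_zpow_eq_units_mul_pow` and `…_of_comap` — (511) and "In particular …"
  in Cossart–Piltant's format: `u = (û₁, …, û_r)` part of a regular system of parameters of `S`,
  `f : Fin r → A`, `∏ f_i ∣ h`, `∏ û_k ∈ √(hS)`, `A → K → K̂₁` and `A → S → K̂₁`, the valuation
  ring `O' = 𝒪_v̂` of `K̂₁` containing `S` and `O = O' ∩ K = 𝒪_v`; conclusion: Laurent monomials
  `g_j ∈ K` in the `f_i` with `g_j = δ̂_j û_j^a` in `K̂₁`, `δ̂_j ∈ Sˣ`, one `a > 0` for all `j`;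
* `exists_adjoin_isRegularLocalRing_of_rsp_powers` — the algebraization interface restated with
  the data (511)–(512) actually deliver: a regular system of parameters `(z₁, …, z_d)` of `S`
  and, for each `j`, an element of `K` equal to `(unit) · z_j^{a_j}` in `K̂₁` (`a_j ≥ 1`); these
  generate an `𝔪_S`-primary ideal, so the conclusion of (LU) for `A` at `v` follows.

What this leaves of the printed proof of Prop. 4.8 (given `CossartJannsenSaito2020` for the
reductions of `ArithmeticalThreefoldsClosedPoints.lean`): the construction of `𝒪_{Ŷ,ŷ}` with
`√(h𝒪_{Ŷ,ŷ}) = (û₁ ⋯ û_r)` (Thm. 1.1 for `Spec Â` by patching, journal Prop. 4.6, and Lemma 4.7 =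
[CoP1] Prop. 6.2 with embedded resolution of surfaces) and the density argument (5101)–(5102)
producing `g_{r+1}, …, g_d` (512).

## Sources

* V. Cossart, O. Piltant, J. Algebra 529 (2019) 268–535 = arXiv:1412.0868, proof of Prop. 4.8
  (v1: Prop. 4.6, p. 53), Lemma 4.7 and (511). [CossartPiltant2019]
* V. Cossart, O. Piltant, *Resolution of singularities of threefolds in positive
  characteristic II*, J. Algebra 321 (2009), Prop. 9.1 (the model of the argument). [cite only]
-/

noncomputable section

namespace Literature.AlgebraicGeometry.Resolution

universe u

open IsLocalRing

namespace CossartPiltantMonomial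

/-! ## Divisors of monomials in prime elements -/

/-- In a cancellative commutative monoid with zero, a divisor of `∏ pᵢ ^ Nᵢ` with all `pᵢ` prime
is a unit times a monomial `∏ pᵢ ^ eᵢ`. (Mathlib's `mul_eq_mul_prime_prod`, applied to the
product of primes indexed by `Σ i, Fin (N i)`.) [folklore] -/
theorem exists_eq_units_mul_prod_pow_of_dvd {M : Type*} [CommMonoidWithZero M]
    [IsCancelMulZero M] {ι : Type*} [Fintype ι] [DecidableEq ι] {p : ι → M}
    (hp : ∀ i, Prime (p i)) (N : ι → ℕ) {f : M} (hf : f ∣ ∏ i, p i ^ N i) :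
    ∃ (c : Mˣ) (e : ι → ℕ), f = c * ∏ i, p i ^ e i := by
  classical
  obtain ⟨g, hg⟩ := hf
  have hprod : ∏ i, p i ^ N i = ∏ x : (Σ i, Fin (N i)), p x.1 := by
    rw [← Finset.univ_sigma_univ, Finset.prod_sigma]
    refine Finset.prod_congr rfl fun i _ => ?_
    show p i ^ N i = ∏ _s : Fin (N i), p i
    rw [Finset.prod_const, Finset.card_univ, Fintype.card_fin]
  have hx : f * g = 1 * ∏ x ∈ (Finset.univ : Finset (Σ i, Fin (N i))), p x.1 := by
    rw [one_mul, ← hprod, hg]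
  obtain ⟨t, -, b, c, -, -, hbc, hfb, -⟩ := mul_eq_mul_prime_prod (fun x _ => hp x.1) hx
  have hb : IsUnit b := IsUnit.of_mul_eq_one c hbc.symm
  have key : ∏ x ∈ t, p x.1 = ∏ i, p i ^ (t.filter fun x => x.1 = i).card := by
    rw [← Finset.prod_fiberwise t Sigma.fst fun x => p x.1]
    refine Finset.prod_congr rfl fun i _ => ?_
    rw [← Finset.prod_const]
    refine Finset.prod_congr rfl fun x hx => ?_
    have hxi : x.1 = i := (Finset.mem_filter.mp hx).2
    simp only [hxi]
  exact ⟨hb.unit, fun i => (t.filter fun x => x.1 = i).card, by rw [hb.unit_spec, hfb, key]⟩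

/-! ## Exponent arithmetic in a commutative group -/

/-- `∏ᵢ (∏_k μ_k ^ e_{ik}) ^ nᵢ = ∏_k μ_k ^ (∑ᵢ nᵢ e_{ik})`: the row vector `n` times the
exponent matrix `e`. [folklore] -/
theorem prod_prod_zpow_zpow {G : Type*} [CommGroup G] {ι κ : Type*} [Fintype ι] [Fintype κ]
    (μ : κ → G) (e : ι → κ → ℤ) (n : ι → ℤ) :
    ∏ i, (∏ k, μ k ^ e i k) ^ n i = ∏ k, μ k ^ ∑ i, n i * e i k := by
  classical
  -- `∏_{i ∈ s} b ^ gᵢ = b ^ (∑_{i ∈ s} gᵢ)` (integer exponents; cf. the ℕ-version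
  -- `Finset.prod_pow_eq_pow_sum`)
  have aux : ∀ (b : G) (s : Finset ι) (g : ι → ℤ), ∏ i ∈ s, b ^ g i = b ^ ∑ i ∈ s, g i := by
    intro b s g
    induction s using Finset.induction_on with
    | empty => simp
    | insert i s hi ih => rw [Finset.prod_insert hi, Finset.sum_insert hi, ih, zpow_add]
  calc ∏ i, (∏ k, μ k ^ e i k) ^ n i = ∏ i, ∏ k, μ k ^ (e i k * n i) := by
        refine Finset.prod_congr rfl fun i _ => ?_
        rw [← Finset.prod_zpow]
        exact Finset.prod_congr rfl fun k _ => (zpow_mul _ _ _).symm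
    _ = ∏ k, ∏ i, μ k ^ (e i k * n i) := Finset.prod_comm
    _ = ∏ k, μ k ^ ∑ i, n i * e i k := by
        refine Finset.prod_congr rfl fun k _ => ?_
        rw [aux]
        exact congrArg _ (Finset.sum_congr rfl fun i _ => mul_comm _ _)

/-! ## The elementary linear algebra of (511) -/

/-- **Cossart–Piltant's "elementary linear algebra" (511), group-theoretic core.** In a
commutative group `G` (think `K̂₁ˣ`) with a homomorphism `w` to a commutative group `H` (think
the value group of `v̂`), let `F_i = C_i ∏_k U_k^{e_{ik}}` (`i, k ∈ ι`) with `w(C_i) = 1`, and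
assume the `w(F_i)` multiplicatively independent. Then there are an integer `a > 0` and an
integer matrix `m` with `∏ᵢ F_i^{m_{ji}} = (∏ᵢ C_i^{m_{ji}}) U_j^a` for every `j` (namely
`a = |det e|`, `m = sign(det e) adj(e)`: the matrix `e` is nonsingular since
`w(F_i) = ∏_k w(U_k)^{e_{ik}}` are independent), and the `w(U_k)` are multiplicatively
independent too ("In particular …" of Lemma 4.7).
[cite: CossartPiltant2019, proof of Prop. 4.8 (arXiv v1: Prop. 4.6, p. 53), (511)] -/
theorem exists_matrix_of_independent {G H : Type*} [CommGroup G] [CommGroup H] (w : G →* H)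
    {ι : Type*} [Fintype ι] [DecidableEq ι] (U C F : ι → G) (e : ι → ι → ℤ)
    (hF : ∀ i, F i = C i * ∏ k, U k ^ e i k) (hC : ∀ i, w (C i) = 1)
    (hind : ∀ n : ι → ℤ, ∏ i, w (F i) ^ n i = 1 → n = 0) :
    ∃ a : ℕ, 0 < a ∧ ∃ m : ι → ι → ℤ,
      (∀ j, ∏ i, F i ^ m j i = (∏ i, C i ^ m j i) * U j ^ (a : ℤ)) ∧
      ∀ n : ι → ℤ, ∏ k, w (U k) ^ n k = 1 → n = 0 := by
  -- values of the `F i`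
  have hwF : ∀ i, w (F i) = ∏ k, w (U k) ^ e i k := fun i => by
    rw [hF, map_mul, hC, one_mul, map_prod]
    exact Finset.prod_congr rfl fun k _ => map_zpow w _ _
  -- the exponent matrix is nonsingular
  set E : Matrix ι ι ℤ := Matrix.of e with hE
  have hdet : E.det ≠ 0 := by
    intro h0
    obtain ⟨n, hn0, hn⟩ := Matrix.exists_vecMul_eq_zero_iff.mpr h0
    refine hn0 (hind n ?_)
    have hcol : ∀ k, ∑ i, n i * e i k = 0 := fun k => by
      have := congr_fun hn k
      simpa [Matrix.vecMul, dotProduct, hE] using this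
    calc ∏ i, w (F i) ^ n i = ∏ i, (∏ k, w (U k) ^ e i k) ^ n i := by simp_rw [hwF]
      _ = ∏ k, w (U k) ^ ∑ i, n i * e i k := prod_prod_zpow_zpow _ _ _
      _ = 1 := by simp [hcol]
  -- `a = |det E|`, `m = sign (det E) • adj E`, `m E = a`
  set a : ℕ := E.det.natAbs with ha
  have ha0 : 0 < a := Int.natAbs_pos.mpr hdet
  set m : ι → ι → ℤ := fun j i => E.det.sign * E.adjugate j i with hm
  have hmE : ∀ j k, ∑ i, m j i * e i k = if j = k then (a : ℤ) else 0 := fun j k => by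
    have hadj := congr_fun (congr_fun (Matrix.adjugate_mul E) j) k
    rw [Matrix.mul_apply, Matrix.smul_apply, Matrix.one_apply, smul_eq_mul] at hadj
    have hadj' : ∑ i, E.adjugate j i * e i k = E.det * if j = k then 1 else 0 := by
      simpa [hE] using hadj
    simp only [hm, mul_assoc]
    rw [← Finset.mul_sum, hadj', ← mul_assoc, Int.sign_mul_self, ← ha]
    split_ifs <;> simp
  -- (511)
  have h511 : ∀ j, ∏ i, F i ^ m j i = (∏ i, C i ^ m j i) * U j ^ (a : ℤ) := fun j => by
    calc ∏ i, F i ^ m j i = ∏ i, (C i ^ m j i * (∏ k, U k ^ e i k) ^ m j i) := by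
          simp_rw [hF, mul_zpow]
      _ = (∏ i, C i ^ m j i) * ∏ i, (∏ k, U k ^ e i k) ^ m j i := Finset.prod_mul_distrib
      _ = (∏ i, C i ^ m j i) * ∏ k, U k ^ ∑ i, m j i * e i k := by rw [prod_prod_zpow_zpow]
      _ = (∏ i, C i ^ m j i) * U j ^ (a : ℤ) := by
          congr 1
          simp_rw [hmE]
          rw [Finset.prod_eq_single j (fun k _ hk => by rw [if_neg (Ne.symm hk), zpow_zero])
            (fun h => absurd (Finset.mem_univ j) h), if_pos rfl]
  refine ⟨a, ha0, m, h511, fun n hn => ?_⟩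
  -- "In particular": `w (U j) ^ a = ∏ i, w (F i) ^ m j i`
  have hUa : ∀ j, w (U j) ^ (a : ℤ) = ∏ i, w (F i) ^ m j i := fun j => by
    have h := congrArg w (h511 j)
    rw [map_prod, map_mul, map_prod, map_zpow] at h
    simp_rw [map_zpow, hC, one_zpow, Finset.prod_const_one, one_mul] at h
    exact h.symm
  have hsum : (fun i => ∑ k, n k * m k i) = 0 := by
    refine hind _ ?_
    calc ∏ i, w (F i) ^ ∑ k, n k * m k i = ∏ k, (∏ i, w (F i) ^ m k i) ^ n k :=
          (prod_prod_zpow_zpow _ _ _).symm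
      _ = ∏ k, (w (U k) ^ n k) ^ (a : ℤ) := by
          refine Finset.prod_congr rfl fun k _ => ?_
          rw [← hUa, ← zpow_mul, ← zpow_mul, mul_comm]
      _ = 1 := by rw [Finset.prod_zpow, hn, one_zpow]
  funext k₀
  have h1 : ∑ k, n k * ∑ i, m k i * e i k₀ = (a : ℤ) * n k₀ := by
    simp_rw [hmE]
    rw [Finset.sum_eq_single k₀ (fun k _ hk => by rw [if_neg hk, mul_zero])
      (fun h => absurd (Finset.mem_univ _) h), if_pos rfl, mul_comm]
  have h2 : ∑ k, n k * ∑ i, m k i * e i k₀ = ∑ i, (∑ k, n k * m k i) * e i k₀ := by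
    simp_rw [Finset.mul_sum, Finset.sum_mul, mul_assoc]
    exact Finset.sum_comm
  have h3 : ∑ i, (∑ k, n k * m k i) * e i k₀ = 0 :=
    Finset.sum_eq_zero fun i _ => by rw [show ∑ k, n k * m k i = 0 from congr_fun hsum i, zero_mul]
  have h4 : (a : ℤ) * n k₀ = 0 := by rw [← h1, h2, h3]
  exact (mul_eq_zero.mp h4).resolve_left (by exact_mod_cast ha0.ne')

/-- **(511) inside a valued field.** `S` a domain inside a field `L` (think `𝒪_{Ŷ,ŷ} ⊆ K̂₁`), `v`
a valuation of `L` with `v ≤ 1` on `S` (the centre of `v̂` is `ŷ`; only `S ⊆ 𝒪_v̂` is used),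
`u_k ∈ S` nonzero, `f_i = c_i ∏_k u_k^{e_{ik}}` with `c_i ∈ Sˣ`, and the values `v(f_i)`
multiplicatively independent. Then for some integer `a > 0`, integer matrix `m` and units
`c'_j ∈ Sˣ`: `∏ᵢ f_i^{m_{ji}} = c'_j u_j^a` in `L` for all `j`, and the `v(u_k)` are
multiplicatively independent.
[cite: CossartPiltant2019, proof of Prop. 4.8 (arXiv v1: Prop. 4.6, p. 53), (511)] -/
theorem exists_prod_zpow_eq_units_mul_pow {S : Type*} [CommRing S] [IsDomain S] {L : Type*}
    [Field L] [Algebra S L] (hSL : Function.Injective (algebraMap S L)) {Γ₀ : Type*}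
    [LinearOrderedCommGroupWithZero Γ₀] (v : Valuation L Γ₀)
    (hS1 : ∀ s : S, v (algebraMap S L s) ≤ 1) {ι : Type*} [Fintype ι] [DecidableEq ι]
    (u : ι → S) (hu0 : ∀ k, u k ≠ 0) (f : ι → S) (c : ι → Sˣ) (e : ι → ι → ℕ)
    (hf : ∀ i, f i = c i * ∏ k, u k ^ e i k)
    (hind : ∀ n : ι → ℤ, ∏ i, v (algebraMap S L (f i)) ^ n i = 1 → n = 0) :
    ∃ a : ℕ, 0 < a ∧ ∃ (m : ι → ι → ℤ) (c' : ι → Sˣ),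
      (∀ j, ∏ i, algebraMap S L (f i) ^ m j i = algebraMap S L (c' j * u j ^ a)) ∧
      ∀ n : ι → ℤ, ∏ k, v (algebraMap S L (u k)) ^ n k = 1 → n = 0 := by
  set φ : S →* L := (algebraMap S L : S →* L) with hφ
  have hφ' : ∀ s, φ s = algebraMap S L s := fun _ => rfl
  have hU0 : ∀ k, algebraMap S L (u k) ≠ 0 := fun k => (map_ne_zero_iff _ hSL).mpr (hu0 k)
  set U : ι → Lˣ := fun k => Units.mk0 _ (hU0 k) with hU
  set C : ι → Lˣ := fun i => Units.map φ (c i) with hC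
  set F : ι → Lˣ := fun i => C i * ∏ k, U k ^ (e i k : ℤ) with hF
  have hUval : ∀ k, (U k : L) = algebraMap S L (u k) := fun _ => rfl
  have hCval : ∀ i, (C i : L) = algebraMap S L (c i) := fun _ => rfl
  have hFval : ∀ i, (F i : L) = algebraMap S L (f i) := fun i => by
    simp only [hF, Units.val_mul, Units.coe_prod, zpow_natCast, Units.val_pow_eq_pow_val, hUval,
      hCval, hf, map_mul, map_prod, map_pow]
  set w : Lˣ →* Γ₀ˣ := Units.map v.toMonoidWithZeroHom.toMonoidHom with hw
  have hwval : ∀ x : Lˣ, (w x : Γ₀) = v (x : L) := fun _ => rfl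
  have hC1 : ∀ i, w (C i) = 1 := fun i => Units.ext (by
    rw [hwval, Units.val_one, hCval]
    exact Valuation.Integers.one_of_isUnit' (c i).isUnit hS1)
  have hind' : ∀ n : ι → ℤ, ∏ i, w (F i) ^ n i = 1 → n = 0 := fun n hn => hind n (by
    have h := congrArg (fun x : Γ₀ˣ => (x : Γ₀)) hn
    simpa only [Units.coe_prod, Units.val_zpow_eq_zpow_val, hwval, hFval, Units.val_one] using h)
  obtain ⟨a, ha, m, h511, hindU⟩ :=
    exists_matrix_of_independent w U C F (fun i k => (e i k : ℤ)) (fun i => rfl) hC1 hind'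
  refine ⟨a, ha, m, fun j => ∏ i, c i ^ m j i, fun j => ?_, fun n hn => hindU n ?_⟩
  · have h := congrArg (fun x : Lˣ => (x : L)) (h511 j)
    simp only [Units.val_mul, Units.coe_prod, Units.val_zpow_eq_zpow_val, hFval, zpow_natCast,
      Units.val_pow_eq_pow_val, hUval] at h
    rw [h, map_mul, map_pow]
    congr 1
    change _ = φ _
    rw [← Units.coe_map, map_prod]
    simp only [map_zpow, Units.coe_prod, Units.val_zpow_eq_zpow_val, Units.coe_map, hφ', hCval]
  · apply Units.ext
    simpa only [Units.coe_prod, Units.val_zpow_eq_zpow_val, hwval, hUval, Units.val_one] using hn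

end CossartPiltantMonomial

/-! ## (511) in Cossart–Piltant's format -/

section CP511

variable {S : Type*} [CommRing S] [IsLocalRing S] {r : ℕ} {u : Fin r → S}
  {A : Type*} [CommRing A] [Algebra A S]
  {K₁ : Type*} [Field K₁] [Algebra S K₁] [Algebra A K₁] [IsScalarTower A S K₁]
  {K : Type*} [Field K] [Algebra A K] [Algebra K K₁] [IsScalarTower A K K₁]

/-- **Cossart–Piltant 2019, proof of Prop. 4.8, (511) and "In particular …" of Lemma 4.7.**
Data: `u = (û₁, …, û_r)` part of a regular system of parameters of the (regular) local ring
`S = 𝒪_{Ŷ,ŷ}`; `f₁, …, f_r ∈ A` with `∏ f_i ∣ h` in `S` (`h = g f₁ ⋯ f_r`) and `û₁ ⋯ û_r ∈ √(hS)`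
(Lemma 4.7: `√(h𝒪_{Ŷ,ŷ}) = (û₁ ⋯ û_r)`); ring maps `A → S → K̂₁` and `A → K → K̂₁` commuting
(`K̂₁ ⊇ 𝒪_{Ŷ,ŷ} ⊇ Â ⊇ A`, `K̂₁ ⊇ K ⊇ A`), `S → K̂₁` injective; a valuation `v` of `K̂₁` (`= v̂`) with
`v ≤ 1` on `S`, such that the values of the `f_i` are multiplicatively (= `ℚ`-linearly)
independent. Conclusion: there are an integer `a > 0`, units `δ̂_j ∈ Sˣ` and elements `g_j ∈ K`
(Laurent monomials in the `f_i`) with `g_j = δ̂_j û_j^a` in `K̂₁` for `1 ≤ j ≤ r` — so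
`g_j ∈ 𝒪_{Ŷ,ŷ} ∩ K` —, and the values `v̂(û₁), …, v̂(û_r)` are independent. Proof as printed:
each `f_i` divides `(û₁ ⋯ û_r)^N`, hence is a unit times a monomial in the prime elements `û_k`;
the exponent matrix is nonsingular by the independence of the `v(f_i)`; take `M = a E⁻¹`,
`a = |det E|`.
[cite: CossartPiltant2019, proof of Prop. 4.8 (arXiv v1: Prop. 4.6, p. 53), Lemma 4.7 and
(511)] -/
theorem IsRsopPart.exists_prod_zpow_eq_units_mul_pow (hu : IsRsopPart u) (f : Fin r → A)
    {h : S} (hh : (∏ i, algebraMap A S (f i)) ∣ h)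
    (hrad : ∏ k, u k ∈ (Ideal.span {h}).radical)
    (hSK₁ : Function.Injective (algebraMap S K₁))
    {Γ₀ : Type*} [LinearOrderedCommGroupWithZero Γ₀] (v : Valuation K₁ Γ₀)
    (hS1 : ∀ s : S, v (algebraMap S K₁ s) ≤ 1)
    (hind : ∀ n : Fin r → ℤ, ∏ i, v (algebraMap A K₁ (f i)) ^ n i = 1 → n = 0) :
    ∃ a : ℕ, 0 < a ∧ ∃ (c : Fin r → Sˣ) (g : Fin r → K),
      (∀ j, algebraMap K K₁ (g j) = algebraMap S K₁ (c j * u j ^ a)) ∧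
      ∀ n : Fin r → ℤ, ∏ k, v (algebraMap S K₁ (u k)) ^ n k = 1 → n = 0 := by
  classical
  haveI := hu.isRegularLocalRing
  haveI := isDomain_of_isRegularLocalRing S
  -- `h ∣ (∏ u_k) ^ N`, so each `f i` divides `∏ u_k ^ N`
  obtain ⟨N, hN⟩ := hrad
  obtain ⟨h', hh'⟩ := Ideal.mem_span_singleton'.mp hN
  have hdiv : (∏ i, algebraMap A S (f i)) ∣ ∏ k, u k ^ N :=
    (hh.trans (Dvd.intro_left h' hh')).trans (dvd_of_eq (Finset.prod_pow _ _ _).symm)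
  have hdiv' : ∀ i, algebraMap A S (f i) ∣ ∏ k, u k ^ N := fun i =>
    (Finset.dvd_prod_of_mem _ (Finset.mem_univ i)).trans hdiv
  choose c e hce using fun i =>
    CossartPiltantMonomial.exists_eq_units_mul_prod_pow_of_dvd hu.prime (fun _ => N) (hdiv' i)
  have hind' : ∀ n : Fin r → ℤ,
      ∏ i, v (algebraMap S K₁ (algebraMap A S (f i))) ^ n i = 1 → n = 0 := fun n hn => by
    refine hind n ?_
    simp_rw [IsScalarTower.algebraMap_apply A S K₁]
    exact hn
  obtain ⟨a, ha, m, c', h511, hindU⟩ :=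
    CossartPiltantMonomial.exists_prod_zpow_eq_units_mul_pow hSK₁ v hS1 u hu.ne_zero
      (fun i => algebraMap A S (f i)) c e hce hind'
  refine ⟨a, ha, c', fun j => ∏ i, algebraMap A K (f i) ^ m j i, fun j => ?_, hindU⟩
  rw [map_prod]
  simp_rw [map_zpow₀, ← IsScalarTower.algebraMap_apply A K K₁, IsScalarTower.algebraMap_apply A S K₁]
  exact h511 j

/-- For a valuation ring `O` of a field and `x ≠ 0`: `v_O(x) = 1 ↔ x ∈ O ∧ x⁻¹ ∈ O`.
[folklore] -/
theorem valuationSubring_valuation_eq_one_iff {F : Type*} [Field F] (O : ValuationSubring F)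
    {x : F} (hx : x ≠ 0) : O.valuation x = 1 ↔ x ∈ O ∧ x⁻¹ ∈ O := by
  rw [← O.valuation_le_one_iff, ← O.valuation_le_one_iff]
  have hmul : O.valuation x * O.valuation x⁻¹ = 1 := by
    rw [← map_mul, mul_inv_cancel₀ hx, map_one]
  constructor
  · intro h1
    refine ⟨h1.le, ?_⟩
    rw [h1, one_mul] at hmul
    exact hmul.le
  · rintro ⟨h1, h2⟩
    refine le_antisymm h1 ?_
    calc (1 : _) = O.valuation x * O.valuation x⁻¹ := hmul.symm
      _ ≤ O.valuation x * 1 := mul_le_mul' le_rfl h2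
      _ = O.valuation x := mul_one _

/-- Transfer of multiplicative independence of values along `O' ∩ F = O`: for nonzero
`x₁, …, x_n ∈ F`, independence of the `v_O(x_i)` is equivalent to independence of the
`v_{O'}(x_i)` in the bigger field. (Both say: `∏ x_i^{n_i}` is a unit of the valuation ring only
for `n = 0`.) [folklore] -/
theorem forall_prod_zpow_valuation_eq_one_iff_of_comap {F L : Type*} [Field F] [Field L]
    [Algebra F L] (O' : ValuationSubring L) (O : ValuationSubring F)
    (hO : O'.comap (algebraMap F L) = O) {ι : Type*} [Fintype ι] (x : ι → F)
    (hx : ∀ i, x i ≠ 0) :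
    (∀ n : ι → ℤ, ∏ i, O.valuation (x i) ^ n i = 1 → n = 0) ↔
      ∀ n : ι → ℤ, ∏ i, O'.valuation (algebraMap F L (x i)) ^ n i = 1 → n = 0 := by
  have hne : ∀ n : ι → ℤ, ∏ i, x i ^ n i ≠ 0 := fun n =>
    Finset.prod_ne_zero_iff.mpr fun i _ => zpow_ne_zero _ (hx i)
  have key : ∀ n : ι → ℤ, ∏ i, O.valuation (x i) ^ n i = 1 ↔
      ∏ i, O'.valuation (algebraMap F L (x i)) ^ n i = 1 := fun n => by
    have h1 : ∏ i, O.valuation (x i) ^ n i = O.valuation (∏ i, x i ^ n i) := by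
      rw [map_prod]; simp_rw [map_zpow₀]
    have h2 : ∏ i, O'.valuation (algebraMap F L (x i)) ^ n i =
        O'.valuation (algebraMap F L (∏ i, x i ^ n i)) := by
      rw [map_prod, map_prod]; simp_rw [map_zpow₀]
    rw [h1, h2, valuationSubring_valuation_eq_one_iff O (hne n),
      valuationSubring_valuation_eq_one_iff O' ((map_ne_zero _).mpr (hne n)), ← hO,
      ValuationSubring.mem_comap, ValuationSubring.mem_comap, map_inv₀]
  exact ⟨fun H n hn => H n ((key n).mpr hn), fun H n hn => H n ((key n).mp hn)⟩

/-- **(511) with the independence hypothesis on `K`, as printed** ("`f₁, …, f_r ∈ A` such that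
`v(f₁), …, v(f_r)` are `ℚ`-linearly independent in `Γ_v`"): the same statement as
`IsRsopPart.exists_prod_zpow_eq_units_mul_pow` with the valuation rings `O' = 𝒪_v̂` of `K̂₁`
(containing `S`) and `O = O' ∩ K = 𝒪_v` of `K`, the format of
`exists_adjoin_isRegularLocalRing_of_generators`.
[cite: CossartPiltant2019, proof of Prop. 4.8 (arXiv v1: Prop. 4.6, p. 53), Lemma 4.7 and
(511)] -/
theorem IsRsopPart.exists_prod_zpow_eq_units_mul_pow_of_comap (hu : IsRsopPart u)
    (f : Fin r → A) {h : S} (hh : (∏ i, algebraMap A S (f i)) ∣ h)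
    (hrad : ∏ k, u k ∈ (Ideal.span {h}).radical)
    (hSK₁ : Function.Injective (algebraMap S K₁))
    (O' : ValuationSubring K₁) (hSO' : ∀ s : S, algebraMap S K₁ s ∈ O')
    (O : ValuationSubring K) (hO : O'.comap (algebraMap K K₁) = O)
    (hind : ∀ n : Fin r → ℤ, ∏ i, O.valuation (algebraMap A K (f i)) ^ n i = 1 → n = 0) :
    ∃ a : ℕ, 0 < a ∧ ∃ (c : Fin r → Sˣ) (g : Fin r → K),
      (∀ j, algebraMap K K₁ (g j) = algebraMap S K₁ (c j * u j ^ a)) ∧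
      ∀ n : Fin r → ℤ, ∏ k, O'.valuation (algebraMap S K₁ (u k)) ^ n k = 1 → n = 0 := by
  classical
  haveI := hu.isRegularLocalRing
  haveI := isDomain_of_isRegularLocalRing S
  have hS1 : ∀ s : S, O'.valuation (algebraMap S K₁ s) ≤ 1 := fun s =>
    (O'.valuation_le_one_iff _).mpr (hSO' s)
  -- the `f i` are nonzero in `K` (they divide `h ≠ 0`... via `S → K̂₁ ← K`)
  obtain ⟨N, hN⟩ := id hrad
  obtain ⟨h', hh'⟩ := Ideal.mem_span_singleton'.mp hN
  have hne : (∏ k, u k) ^ N ≠ 0 := pow_ne_zero _ (Finset.prod_ne_zero_iff.mpr fun k _ => hu.ne_zero k)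
  have hh0 : h ≠ 0 := fun h0 => hne (by rw [← hh', h0, mul_zero])
  have hf0 : ∀ i, algebraMap A K (f i) ≠ 0 := fun i hi => by
    have h1 : algebraMap A S (f i) ∣ h := (Finset.dvd_prod_of_mem _ (Finset.mem_univ i)).trans hh
    have h2 : algebraMap A S (f i) ≠ 0 := fun h0 => hh0 (zero_dvd_iff.mp (h0 ▸ h1))
    have h3 : algebraMap S K₁ (algebraMap A S (f i)) = 0 := by
      rw [← IsScalarTower.algebraMap_apply, IsScalarTower.algebraMap_apply A K K₁, hi, map_zero]
    exact h2 ((map_eq_zero_iff _ hSK₁).mp h3)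
  have hind' : ∀ n : Fin r → ℤ, ∏ i, O'.valuation (algebraMap A K₁ (f i)) ^ n i = 1 → n = 0 := by
    have H := (forall_prod_zpow_valuation_eq_one_iff_of_comap O' O hO _ hf0).mp hind
    simpa only [← IsScalarTower.algebraMap_apply] using H
  exact hu.exists_prod_zpow_eq_units_mul_pow f hh hrad hSK₁ O'.valuation hS1 hind'

end CP511

/-! ## The algebraization interface with the data of (511)–(512) -/

section Assembly

variable {A : Type u} [CommRing A] [IsDomain A] [IsLocalRing A]
  {K : Type u} [Field K] [Algebra A K] [IsFractionRing A K]

/-- **Cossart–Piltant 2019, end of the proof of Prop. 4.8, from the output of (511)–(512).**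
The algebraization statement `exists_adjoin_isRegularLocalRing_of_generators` with its input
"finitely many elements of `𝔪_S` coming from `K` generating an `𝔪_S`-primary ideal" replaced by
what (511)–(512) deliver: generators `z₁, …, z_d` of `𝔪_S` (in the source the regular system of
parameters `(û₁, …, û_r, u'_{r+1}, …, u'_d)` of `S = 𝒪_{Ŷ,ŷ}`) and, for each `j`, an element
`g_j ∈ K` with `g_j = δ_j z_j^{a_j}` in `K̂₁`, `δ_j ∈ Sˣ`, `a_j ≥ 1` (in the source
`g_j = δ̂_j û_j^a`, `j ≤ r`, (511), and `g_j = (∏ δ̂_i^{-m_{ij}}) u'_j{}^a`, `j > r`, (512)). Since a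
prime ideal containing all `δ_j z_j^{a_j}` contains all `z_j`, hence is `𝔪_S`, the conclusion of
(LU) for `A` at `v` follows: some finitely generated `A[t] ⊆ 𝒪_v` is regular at the centre of
`v`. [cite: CossartPiltant2019, proof of Prop. 4.8 (arXiv v1: Prop. 4.6, p. 53), (511)–(512)
and the following paragraph] -/
theorem exists_adjoin_isRegularLocalRing_of_rsp_powers
    (k : Type u) [Field k] [Algebra k A] [Algebra.EssFiniteType k A]
    {K₁ : Type u} [Field K₁] [Algebra (AdicCompletion (maximalIdeal A) A) K₁] [Algebra A K₁]
    [IsScalarTower A (AdicCompletion (maximalIdeal A) A) K₁] [Algebra K K₁] [IsScalarTower A K K₁]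
    (hP₁ : RingHom.ker (algebraMap (AdicCompletion (maximalIdeal A) A) K₁) ∈
      minimalPrimes (AdicCompletion (maximalIdeal A) A))
    (hK₁ : ∀ z : K₁, ∃ a b : AdicCompletion (maximalIdeal A) A,
      z = algebraMap _ K₁ a / algebraMap _ K₁ b)
    {S : Type u} [CommRing S] [IsRegularLocalRing S] [Algebra (AdicCompletion (maximalIdeal A) A) S]
    [IsLocalHom (algebraMap (AdicCompletion (maximalIdeal A) A) S)]
    [Algebra.EssFiniteType (AdicCompletion (maximalIdeal A) A) S] [Algebra A S]
    [IsScalarTower A (AdicCompletion (maximalIdeal A) A) S] [Algebra S K₁]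
    [IsScalarTower (AdicCompletion (maximalIdeal A) A) S K₁]
    (hSK₁ : Function.Injective (algebraMap S K₁))
    (halg : ∀ x : S, ∃ p : Polynomial A, (∃ i, p.coeff i ∉ maximalIdeal A) ∧
      p.eval₂ (algebraMap A S) x ∈ maximalIdeal S)
    (O' : ValuationSubring K₁) (hSO' : ∀ s : S, algebraMap S K₁ s ∈ O')
    (hdomS : ∀ s ∈ maximalIdeal S, O'.valuation (algebraMap S K₁ s) < 1)
    (O : ValuationSubring K) (hO : O'.comap (algebraMap K K₁) = O)
    -- the output of (511)–(512)
    {d : ℕ} (z : Fin d → S) (hz : Ideal.span (Set.range z) = maximalIdeal S)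
    (a : Fin d → ℕ) (ha : ∀ j, 0 < a j) (c : Fin d → Sˣ) (g : Fin d → K)
    (hg : ∀ j, algebraMap K K₁ (g j) = algebraMap S K₁ (c j * z j ^ a j)) :
    ∃ (t : Finset K) (h : (Algebra.adjoin A (t : Set K)).toSubring ≤ O.toSubring),
      IsRegularLocalRing (Localization.AtPrime
        (Ideal.comap (Subring.inclusion h) (maximalIdeal O))) := by
  classical
  let G : Finset S := Finset.univ.image fun j => (c j : S) * z j ^ a j
  set g' : S → K := fun s => if hs : ∃ j, (c j : S) * z j ^ a j = s then g hs.choose else 0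
    with hg'
  refine exists_adjoin_isRegularLocalRing_of_generators k hP₁ hK₁ hSK₁ halg O' hSO' hdomS O hO
    G g' ?_ ?_ ?_
  · intro s hs
    obtain ⟨j, -, rfl⟩ := Finset.mem_image.mp hs
    have hex : ∃ j', (c j' : S) * z j' ^ a j' = (c j : S) * z j ^ a j := ⟨j, rfl⟩
    rw [hg']
    dsimp only
    rw [dif_pos hex, hg, hex.choose_spec]
  · intro s hs
    obtain ⟨j, -, rfl⟩ := Finset.mem_image.mp hs
    have hzj : z j ∈ maximalIdeal S := hz ▸ Ideal.subset_span ⟨j, rfl⟩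
    exact Ideal.mul_mem_left _ _ (Ideal.pow_mem_of_mem _ hzj _ (ha j))
  · intro Q hQ hGQ
    have hle : maximalIdeal S ≤ Q := by
      rw [← hz, Ideal.span_le]
      rintro _ ⟨j, rfl⟩
      have hmem : (c j : S) * z j ^ a j ∈ Q :=
        hGQ _ (Finset.mem_image.mpr ⟨j, Finset.mem_univ _, rfl⟩)
      have hzQ : z j ^ a j ∈ Q := (hQ.mem_or_mem hmem).resolve_left fun hc =>
        hQ.ne_top (Q.eq_top_of_isUnit_mem hc (c j).isUnit)
      exact hQ.mem_of_pow_mem _ hzQ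
    exact ((maximalIdeal.isMaximal S).eq_of_le hQ.ne_top hle).symm

end Assembly

end Literature.AlgebraicGeometry.Resolution

end
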